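import Mathlib
import HarnessLib
import Summits.HubbardSuperconductivity.HubbardSuperconductivity.Theorems.KLProgrammeKLRegimeSplitEdgeFactsLevelSetFloorColumns

/-!
# Route `KLProgramme` — edge facts for the pair masses ACROSS TRANSFERS, XVI: CROSSING COLUMNS of the frame band from the two ends of a column —
# `e_K(a, 0) ≤ −2cos(2πa/L) − 2 − μ + coeffNorm 0 K`, `e_K(a, ⌊L/2⌋) ≥ −2cos(2πa/L) + 2cos(π/L) − μ − coeffNorm 0 K`; hence an explicit column set for the level-set floor

Cell gate-hubbard-kl, seat hubbard-kl-k3c1-p1 (g21; child-1 lineage).  Row 29 (`kllf_levelSet_card_ge`) floors `#{k⃗ : A ≤ e_K(p_k⃗) ≤ B}` by `#C·((B − A)L/(2π(4 + coeffNorm 1 K)) − 1)`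
for any set `C` of columns `k⃗₀ = a` containing a point below `A` and a point above `B`.  THIS FILE evaluates the band at the two ends of a column — the bottom `(a, 0)`
(`cos p₂ = 1`) and the (near-)top `(a, ⌊L/2⌋)` (`cos p₂ = cos(2π⌊L/2⌋/L) ≤ −cos(π/L)`, both parities) — so a column crosses `[A, B]` as soon as
`−2cos(2πa/L) − 2 − μ + coeffNorm 0 K < A` and `B < −2cos(2πa/L) + 2cos(π/L) − μ − coeffNorm 0 K`:

* §1 `kllc_cos_two_pi_half_le`: `cos(2π⌊L/2⌋/L) ≤ −cos(π/L)` (`1 ≤ L`); the band at the two ends (`kllc_nambuXiCT_bottom_le`, `kllc_nambuXiCT_top_ge`);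
* §2 **`kllc_column_crosses`**: the two inequalities ⟹ the column `a` is a crossing column in the sense of row 29;
* §3 **`kllc_levelSet_card_ge_of_criterion`**: `#{k⃗ : A ≤ e_K ≤ B} ≥ #{a : criterion}·((B − A)L/(2π(4 + coeffNorm 1 K)) − 1)`.

E1 reads the criterion on the NEGATIVE window `[−√(5/8)Λ_n, −Λ_n/√2]` of the (D3′) layer (or its mirror) and counts the `a` from the μ-window (`cos(2πa/L)` between two
explicit levels — a positive fraction of the `L` columns).  Everything is proved; no definitions; nothing asserts any slot, stub, K3 or SC. [folklore]
-/

noncomputable section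

namespace Summit.HubbardSuperconductivity.HubbardSuperconductivity.Theorems.KLRegimeSplit

set_option linter.dupNamespace false -- summit = problem name (single-conjunct summit), D-0017

open Real Finset Literature.MathematicalPhysics.QuantumLattice Literature.Probability.LatticeModels
open Summit.HubbardSuperconductivity.HubbardSuperconductivity.Theorems.KLProgrammeLegKernels

/-! ## §1 The band at the two ends of a column -/

/-- `cos(2π⌊L/2⌋/L) ≤ −cos(π/L)` for `1 ≤ L` (even `L`: `cos π = −1`; odd `L`: `cos(π − π/L) = −cos(π/L)`). [folklore] -/
theorem kllc_cos_two_pi_half_le {L : ℕ} (hL : 1 ≤ L) : Real.cos (2 * π * ((L / 2 : ℕ) : ℝ) / L) ≤ -Real.cos (π / L) := by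
  rcases Nat.even_or_odd L with ⟨q, hq⟩ | ⟨q, hq⟩
  · -- `L = q + q`
    have hq2 : L / 2 = q := by omega
    have hqr : (L : ℝ) = 2 * q := by rw [hq]; push_cast; ring
    have hq0 : (0 : ℝ) < q := by
      have : 0 < q := by omega
      exact_mod_cast this
    have hang : 2 * π * ((L / 2 : ℕ) : ℝ) / L = π := by
      rw [hq2, hqr]; field_simp
    rw [hang, Real.cos_pi]
    linarith [Real.cos_le_one (π / L)]
  · -- `L = 2q + 1`
    have hq2 : L / 2 = q := by omega
    have hqr : (L : ℝ) = 2 * q + 1 := by rw [hq]; push_cast; ring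
    have hne : (2 * (q : ℝ) + 1) ≠ 0 := by positivity
    have hang : 2 * π * ((L / 2 : ℕ) : ℝ) / L = π - π / L := by
      rw [hq2, hqr]; field_simp; ring
    rw [hang, Real.cos_pi_sub]

section Columns

variable {L : ℕ} [NeZero L] (μ : ℝ) (K : TrigPolyC4v)

/-- **The bottom of a column**: `e_K(a, 0) ≤ −2cos(2πa/L) − 2 − μ + coeffNorm 0 K`. [folklore] -/
theorem kllc_nambuXiCT_bottom_le (a : ZMod L) :
    nambuXiCT L μ K ![a, 0] ≤ -2 * Real.cos (2 * π * (a.val : ℝ) / L) - 2 - μ + K.coeffNorm 0 := by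
  have hK := (abs_le.1 (TrigPolyC4v.abs_eval_le_coeffNorm K (latticeMomentum L ![a, 0]))).1
  have hband : torusBand L ![a, 0] = -2 * Real.cos (2 * π * (a.val : ℝ) / L) - 2 := by
    simp [torusBand, Fin.sum_univ_two, latticeMomentum]
    ring
  rw [nambuXiCT, hband]
  linarith

/-- **The (near-)top of a column**: `e_K(a, ⌊L/2⌋) ≥ −2cos(2πa/L) + 2cos(π/L) − μ − coeffNorm 0 K`. [folklore] -/
theorem kllc_nambuXiCT_top_ge (a : ZMod L) :
    -2 * Real.cos (2 * π * (a.val : ℝ) / L) + 2 * Real.cos (π / L) - μ - K.coeffNorm 0 ≤ nambuXiCT L μ K ![a, ((L / 2 : ℕ) : ZMod L)] := by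
  have hL : 1 ≤ L := Nat.one_le_iff_ne_zero.2 (NeZero.ne L)
  have hK := (abs_le.1 (TrigPolyC4v.abs_eval_le_coeffNorm K (latticeMomentum L ![a, ((L / 2 : ℕ) : ZMod L)]))).2
  have hval : (((L / 2 : ℕ) : ZMod L)).val = L / 2 := by
    rw [ZMod.val_natCast]; exact Nat.mod_eq_of_lt (Nat.div_lt_self (by omega) (by norm_num))
  have hband : torusBand L ![a, ((L / 2 : ℕ) : ZMod L)] =
      -2 * Real.cos (2 * π * (a.val : ℝ) / L) - 2 * Real.cos (2 * π * ((L / 2 : ℕ) : ℝ) / L) := by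
    simp only [torusBand, Fin.sum_univ_two, latticeMomentum, Matrix.cons_val_zero, Matrix.cons_val_one, hval]
    ring
  have hcos := kllc_cos_two_pi_half_le hL
  rw [nambuXiCT, hband]
  linarith

/-! ## §2 The crossing criterion -/

/-- **A column crosses the window** `[A, B]` as soon as `−2cos(2πa/L) − 2 − μ + coeffNorm 0 K < A` and `B < −2cos(2πa/L) + 2cos(π/L) − μ − coeffNorm 0 K`: it then
contains a point with `e_K < A` and a point with `B < e_K` (the hypothesis of row 29's level-set floor). [folklore] -/
theorem kllc_column_crosses {A B : ℝ} (a : ZMod L) (hlo : -2 * Real.cos (2 * π * (a.val : ℝ) / L) - 2 - μ + K.coeffNorm 0 < A)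
    (hhi : B < -2 * Real.cos (2 * π * (a.val : ℝ) / L) + 2 * Real.cos (π / L) - μ - K.coeffNorm 0) :
    (∃ k : TorusSite 2 L, k 0 = a ∧ nambuXiCT L μ K k < A) ∧ ∃ k : TorusSite 2 L, k 0 = a ∧ B < nambuXiCT L μ K k :=
  ⟨⟨![a, 0], by simp, (kllc_nambuXiCT_bottom_le μ K a).trans_lt hlo⟩,
    ⟨![a, ((L / 2 : ℕ) : ZMod L)], by simp, hhi.trans_le (kllc_nambuXiCT_top_ge μ K a)⟩⟩

/-! ## §3 The level-set floor with the explicit column set -/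

/-- **Level-set floor from the column criterion**: with `C = {a : −2cos(2πa/L) − 2 − μ + coeffNorm 0 K < A ∧ B < −2cos(2πa/L) + 2cos(π/L) − μ − coeffNorm 0 K}`,
`#C·((B − A)L/(2π(4 + coeffNorm 1 K)) − 1) ≤ #{k⃗ : A ≤ e_K(p_k⃗) ≤ B}` (`A ≤ B`). [folklore] -/
theorem kllc_levelSet_card_ge_of_criterion {A B : ℝ} (hAB : A ≤ B) :
    (((univ : Finset (ZMod L)).filter fun a =>
          -2 * Real.cos (2 * π * (a.val : ℝ) / L) - 2 - μ + K.coeffNorm 0 < A ∧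
            B < -2 * Real.cos (2 * π * (a.val : ℝ) / L) + 2 * Real.cos (π / L) - μ - K.coeffNorm 0).card : ℝ) *
        ((B - A) * L / (2 * π * (4 + K.coeffNorm 1)) - 1) ≤
      (((univ : Finset (TorusSite 2 L)).filter fun k => A ≤ nambuXiCT L μ K k ∧ nambuXiCT L μ K k ≤ B).card : ℝ) := by
  classical
  refine kllf_levelSet_card_ge μ K hAB _ fun a ha => ?_
  obtain ⟨-, h1, h2⟩ := mem_filter.1 ha
  exact kllc_column_crosses μ K a h1 h2

end Columns

end Summit.HubbardSuperconductivity.HubbardSuperconductivity.Theorems.KLRegimeSplit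

end
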